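import Mathlib.Algebra.BigOperators.Group.Finset.Piecewise
import Mathlib.Algebra.Order.BigOperators.Ring.Finset
import Mathlib.Algebra.Group.Submonoid.Basic
import Mathlib.CategoryTheory.Category.Basic
import Mathlib.Topology.Homeomorph.Defs
import Mathlib.Algebra.Group.Subgroup.Defs
import HarnessLib

/-!
# [IUTchI] §3, Remarks 3.2.1 (ii), 3.2.2, 3.2.3 (ii), 3.3.1, 3.4.1, 3.4.2, 3.4.3 (ii)
# (remarks to Examples 3.2–3.4: Frobenioids at bad / good / archimedean primes)

S. Mochizuki, *Inter-universal Teichmüller theory I: construction of Hodge theaters*, §3, kurims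
final manuscript (May 2020) pp. 73–83 [claim: Mochizuki2012, status: disputed].  Second file of the
wave-2 row W2-L5-01a (seat abc-iut-L3-t8); one `/-! -/` section per Remark, checkable content as
real definitions / `Prop`-valued predicates (nothing of the series is asserted), prose indexed
("noted").  The companion Remarks 3.2.1 (i), 3.2.3 (i), 3.2.4, 3.3.2, 3.4.3 (i) are typed by the
owner of Examples 3.2–3.4 (seat abc-iut-L5-t2: `SplitFrobenioids`, `BadLocalFrobenioid`,
`LocalFrobenioidsArch`, `TemperedFrobenioidConventions`) and are NOT here.

Bookkeeping note for `ThetaHodgeTheatersRemarksA.lean` (same seat): its sections on Rmk 3.1.6 and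
Rmk 3.1.7 (iv) are a SECONDARY READING — statement of record = abc-iut-L5-t2
(`InitialThetaDataRemarks`, `KappaCoricGalois`); TODO-merge:abc-iut-L5-t2.  (They add the proof of
the p. 69 clause "center-free ⇒ cartesian", `KappaSol.toPullback_bijective`.)

## What is typed here

* **Rmk 3.2.1 (ii)** (p. 74): prose (why the series does not develop a "mono-anabelian geometry
  of categories") — noted.
* **Rmk 3.2.2** (p. 74): "`Φ_{C⊢_v}` is not absolutely primitive [[FrdII] Ex. 1.1 (ii)] … [but]
  there exists a positive integer `N` such that `N·Φ_{C⊢_v}` is absolutely primitive" — the generic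
  predicates `Submonoid.IsNearlyContainedIn` / `NearlyAbsolutelyPrimitive` (uniform `N` over the
  fibres), the printed "as is easily verified" PROVED in the generic form a finitely generated
  monoid needs (`of_finset_closure`), and the printed claim as a predicate on the (abstract) fibre
  data of `C⊢_v` (TODO-merge:abc-iut-L5-t2 `BadLocalFrobenioid.Cdash`, abc-iut-L1-t4
  `PadicFrd.Datum.IsAbsolutelyPrimitive`).
* **Rmk 3.2.3 (ii)** (p. 75): the injection `𝒪^×(T_A^÷) ↪ 𝒪^×(B^÷)` along a linear morphism
  `ψ : B → T_A` ([FrdI] Prop. 1.11 (iv)) and "one may pull back sections … to `B`" — predicate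
  `InjectiveAlongLinear` on abstract birational-units data (`S3RemarksLocal.BiratUnits`).
* **Rmk 3.3.1, 3.4.1** (pp. 79, 82): "a similar remark to Remark 3.2.1 applies" — noted; the
  reading of "reconstructed category-theoretically / algorithmically" is the owner's
  `ReconstructibleAlong` (abc-iut-L5-t2, `SplitFrobenioids.lean`).
* **Rmk 3.4.2** (p. 82): the Kummer structure `κ_v` "is completely equivalent to" the pair
  (Aut-holomorphic structure on `𝒪^▷(C_v)^gp`, co-holomorphicization `𝒪^▷(C_v)^gp → 𝒜_{D_v}`) —
  predicate `KummerStructureRecoverable`; the "elementary fact" it rests on — "every holomorphic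
  automorphism of the complex Lie group `ℂ^×` that preserves the submonoid of elements of norm
  `≤ 1` is equal to the identity" — is PROVED over Mathlib in the sibling file
  `PuncturedPlaneHolomorphicAutomorphisms.lean` (theorem `holAutUnits_eq_id_of_preservesDisc`, same
  seat; no import either way); the compatibility with the logarithm of [AbsTopIII] Cor. 4.5 is noted
  (owner abc-iut-L4-t2, `ArchimedeanLogFrobenius`).
* **Rmk 3.4.3 (ii)** (p. 83): "holomorphic Belyi cuspidalization" ("routine details left to the
  reader" — noted) and its consequence "the set of NF-points … may be reconstructed via a functorial
  algorithm from the [abstract] Aut-holomorphic space `D_v`" — predicate `NFPointsFunctorial` on a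
  pair of Aut-holomorphic spaces with marked NF-points (functoriality reading of "reconstruction";
  TODO-merge:abc-iut-L4-t2 `AutHolStructure` / [AbsTopII] §3 Belyi cuspidalization).

Local shapes live in the namespace `S3RemarksLocal` (distinct from the owner's `S3Local`).
-/

namespace Literature.IUT.HodgeTheaters

open CategoryTheory

universe u v w

/-! ## Remark 3.2.1 (ii) ([IUTchI] Rmk 3.2.1 (ii) p.74) — noted

"One reason that we do not develop in detail here a 'mono-anabelian approach to the geometry of
categories' along the lines of [AbsTopIII] is that … much of the category-theoretic reconstruction
theory of [FrdI], [FrdII], and [EtTh] is not of essential importance in the development of the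
theory of the present series of papers. … one could instead simply work with the data consisting of
'the category constituted by the Frobenioid equipped with its pre-Frobenioid structure' [cf. [FrdI],
Definition 1.1, (iv)]. Nevertheless, we chose to apply the theory … because it renders explicit
precisely which structures arising from scheme-theory are 'categorically intrinsic' …"  Prose;
status: noted.  (Part (i) — the reading of "reconstructed category-theoretically" — is the owner's
`ReconstructibleAlong`, seat abc-iut-L5-t2.) -/

/-! ## Remark 3.2.2 ([IUTchI] Rmk 3.2.2 p.74)

"Although the submonoid `Φ_{C⊢_v}` is not 'absolutely primitive' in the sense of [FrdII], Example
1.1, (ii), it is 'very close to being absolutely primitive', in the sense that [as is easily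
verified] there exists a positive integer `N` such that `N·Φ_{C⊢_v}` is absolutely primitive.  This
proximity to absolute primitiveness may also be seen in the existence of the characteristic
splittings `τ⊢_v`." (last sentence: prose)

[FrdII] Ex. 1.1 (ii): `Φ` is absolutely primitive iff `Φ(K') ⊆ Λ·ord(ℚ_p^×)` for every object
`Spec K'` of the base.  We write monoids multiplicatively (Mathlib), so "`N·Φ ⊆ R`" reads
"`x ^ N ∈ R` for `x ∈ Φ`". -/

/-- `Φ` is *nearly contained in* `R`: "there exists a positive integer `N` such that `N·Φ ⊆ R`"
(multiplicatively: `x ^ N ∈ R` for all `x ∈ Φ`) — the shape of Rmk 3.2.2 at one fibre.  Declared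
deliberately in Mathlib's `Submonoid` namespace as a dot-notation extension (`Φ.IsNearlyContainedIn R`);
no Mathlib declaration of this name exists. [claim: Mochizuki2012, status: disputed] -/
def _root_.Submonoid.IsNearlyContainedIn {M : Type u} [Monoid M] (Φ R : Submonoid M) : Prop :=
  ∃ N : ℕ, 0 < N ∧ ∀ x ∈ Φ, x ^ N ∈ R

/-- Rmk 3.2.2, "as is easily verified", in the generic form: a submonoid generated by finitely many
elements each of which has some positive power in `R` is nearly contained in `R` (take `N` = the
product of the exponents). PROVED (dot-notation extension in Mathlib's `Submonoid` namespace, as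
above). [claim: Mochizuki2012, status: disputed] -/
theorem _root_.Submonoid.IsNearlyContainedIn.of_finset_closure {M : Type u} [CommMonoid M]
    (R : Submonoid M) (s : Finset M) (h : ∀ x ∈ s, ∃ n : ℕ, 0 < n ∧ x ^ n ∈ R) :
    (Submonoid.closure (s : Set M)).IsNearlyContainedIn R := by
  classical
  -- choose an exponent for each generator
  let n : M → ℕ := fun x => if hx : x ∈ s then Classical.choose (h x hx) else 1
  have hn : ∀ x ∈ s, 0 < n x ∧ x ^ n x ∈ R := fun x hx => by
    simp only [n, dif_pos hx]
    exact Classical.choose_spec (h x hx)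
  refine ⟨∏ x ∈ s, n x, Finset.prod_pos fun x hx => (hn x hx).1, fun x hx => ?_⟩
  induction hx using Submonoid.closure_induction with
  | mem y hy =>
    obtain ⟨k, hk⟩ := Finset.dvd_prod_of_mem n (Finset.mem_coe.mp hy)
    rw [hk, pow_mul]
    exact R.pow_mem (hn y (Finset.mem_coe.mp hy)).2 k
  | one => rw [one_pow]; exact R.one_mem
  | mul y z _ _ hy hz => rw [mul_pow]; exact R.mul_mem hy hz

/-- Fibrewise version for a divisor monoid `Φ` on a base with object type `Obj`
("`Φ(K') ⊆ …` for every `Spec K'`"): `Φ` is *nearly absolutely primitive* relative to the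
reference submonoids `R` (to be `Λ·ord(ℚ_p^×) ⊆ Φ₀(K')^gp`, [FrdII] Ex. 1.1 (ii)) if ONE positive
integer `N` works at every object.  With `Obj`, `Φ`, `R` the fibre data of `C⊢_v` (Ex. 3.2 (iv):
`Φ_{C⊢_v} = ℕ·log_Φ(q̲_v)|_{D⊢_v}`; TODO-merge:abc-iut-L5-t2 `BadLocalFrobenioid.Cdash`,
abc-iut-L1-t4 `PadicFrd.Datum.IsAbsolutelyPrimitive`) this is the printed claim of Rmk 3.2.2.
[claim: Mochizuki2012, status: disputed] -/
def NearlyAbsolutelyPrimitive {Obj : Type u} {ι : Obj → Type v} [∀ A, Monoid (ι A)]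
    (Φ R : ∀ A, Submonoid (ι A)) : Prop :=
  ∃ N : ℕ, 0 < N ∧ ∀ (A : Obj), ∀ x ∈ Φ A, x ^ N ∈ R A

/-- Rmk 3.2.2, first clause, fibrewise: "`Φ_{C⊢_v}` is not absolutely primitive" — at some object
the divisor monoid is not contained in the reference submonoid. [claim: Mochizuki2012, status: disputed] -/
def NotAbsolutelyPrimitive {Obj : Type u} {ι : Obj → Type v} [∀ A, Monoid (ι A)]
    (Φ R : ∀ A, Submonoid (ι A)) : Prop :=
  ∃ A : Obj, ¬ Φ A ≤ R A

/-- A uniform `N` gives near containment at each fibre. PROVED. [claim: Mochizuki2012, status: disputed] -/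
theorem NearlyAbsolutelyPrimitive.isNearlyContainedIn {Obj : Type u} {ι : Obj → Type v}
    [∀ A, Monoid (ι A)] {Φ R : ∀ A, Submonoid (ι A)} (h : NearlyAbsolutelyPrimitive Φ R) (A : Obj) :
    (Φ A).IsNearlyContainedIn (R A) := by
  obtain ⟨N, hN, hΦ⟩ := h
  exact ⟨N, hN, hΦ A⟩

/-! ## Remark 3.2.3 (ii) ([IUTchI] Rmk 3.2.3 (ii) p.75)

"Suppose that `A ∈ Ob(D_v)` lies in the image of the natural functor `D^Θ_v ⊆ (D_v)_{Ÿ_v} → D_v`,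
and that `ψ : B → T_A` is a linear morphism in the Frobenioid `F̲_v`.  Then `ψ` induces an injective
homomorphism `𝒪^×(T_A^÷) ↪ 𝒪^×(B^÷)` [cf. [FrdI], Proposition 1.11, (iv)].  In particular, one may
pull-back sections of the monoid `𝒪^▷_{C^Θ_v}(−)` on `D^Θ_v` of Example 3.2, (v), to `B`.  Such
pull-backs are useful, for instance, when one considers the roots of `Θ̲_v`, as in the theory of
[EtTh], §5." -/

namespace S3RemarksLocal

/-- Shape of the data Rmk 3.2.3 (ii) speaks about: a category `F` (the Frobenioid `F̲_v`,
TODO-merge:abc-iut-L5-t2 `BadLocalFrobenioid.Fv`) with its class of *linear* morphisms ([FrdI]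
Def. 1.2 (iii); TODO-merge:abc-iut-L1 Frobenioids `PreFrobenioidMorphisms`), and the groups of units
`𝒪^×(A^÷)` of the birationalizations with their contravariant pull-back maps ([FrdI] §4).
[claim: Mochizuki2012, status: disputed] -/
structure BiratUnits (F : Type u) [Category.{v} F] where
  /-- "linear morphism" of the Frobenioid -/
  IsLinear : ∀ {A B : F}, (A ⟶ B) → Prop
  /-- `A ↦ 𝒪^×(A^÷)`, the units of the birationalization -/
  units : F → Type w
  /-- group structure on `𝒪^×(A^÷)` -/
  [instGroup : ∀ A, CommGroup (units A)]
  /-- pull-back of units along a morphism `B → A` -/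
  pull : ∀ {B A : F}, (B ⟶ A) → (units A →* units B)

/-- the group structure on `𝒪^×(A^÷)` recorded in the data. [claim: Mochizuki2012, status: disputed] -/
instance BiratUnits.instCommGroupUnits {F : Type u} [Category.{v} F] (U : BiratUnits.{u, v, w} F)
    (A : F) : CommGroup (U.units A) :=
  U.instGroup A

end S3RemarksLocal

/-- Rmk 3.2.3 (ii) (with [FrdI] Prop. 1.11 (iv)): along a LINEAR morphism `ψ : B → A` the
pull-back `𝒪^×(A^÷) → 𝒪^×(B^÷)` is injective — so sections of a units-valued monoid over `A`
(e.g. `𝒪^▷_{C^Θ_v}(−)` at `T_A`) pull back faithfully to `B`.  A predicate on the birational-units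
data `U`. [claim: Mochizuki2012, status: disputed] -/
def InjectiveAlongLinear {F : Type u} [Category.{v} F] (U : S3RemarksLocal.BiratUnits.{u, v, w} F) :
    Prop :=
  ∀ {B A : F} (ψ : B ⟶ A), U.IsLinear ψ → Function.Injective (U.pull ψ)

/-! ## Remark 3.3.1 ([IUTchI] Rmk 3.3.1 p.79) — noted

"A similar remark to Remark 3.2.1 [i.e., concerning the phrase 'reconstructed
category-theoretically'] applies to the Frobenioids `C_v`, `C⊢_v` constructed in Example 3.3."
Status: noted; the reading is the owner's `ReconstructibleAlong` applied in `SplitFrobenioids.lean`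
(Ex. 3.3, seat abc-iut-L5-t2). -/

/-! ## Remark 3.4.1 ([IUTchI] Rmk 3.4.1 p.82) — noted

"A similar remark to Remark 3.2.1 … applies to the phrase 'algorithmically reconstructed' that was
applied in the discussion of Example 3.4."  Status: noted (same reading; `LocalFrobenioidsArch.lean`,
seat abc-iut-L5-t2). -/

/-! ## Remark 3.4.2 ([IUTchI] Rmk 3.4.2 p.82)

"One way to think of the Kummer structure `κ_v : 𝒪^▷(C_v) ↪ 𝒜_{D_v}` … is as follows.  In the
terminology of [AbsTopIII], Definition 2.1, (i), (iv), the structure of CAF on `𝒜_{D_v}` determines,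
via pull-back by `κ_v`, an Aut-holomorphic structure on the groupification `𝒪^▷(C_v)^gp` of
`𝒪^▷(C_v)`, together with a [tautological!] co-holomorphicization `𝒪^▷(C_v)^gp → 𝒜_{D_v}`.
Conversely, if one starts with this Aut-holomorphic structure …, together with the
co-holomorphicization …, then one verifies immediately that one may recover the inclusion of
topological monoids `κ_v`.  [Indeed, this follows immediately from [AbsTopIII], Corollary 2.3,
together with the elementary fact that every holomorphic automorphism of the complex Lie group `ℂ^×`
that preserves the submonoid of elements of norm `≤ 1` is equal to the identity.]  That is to say, …
the Kummer structure `κ_v` is completely equivalent to the collection of data consisting of the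
Aut-holomorphic structure [induced by `κ_v`] on the groupification `𝒪^▷(C_v)^gp` of `𝒪^▷(C_v)`,
together with the co-holomorphicization [induced by `κ_v`] `𝒪^▷(C_v)^gp → 𝒜_{D_v}`. … the
co-holomorphicization induced by `κ_v` is compatible with the logarithm operation discussed in
[AbsTopIII], Corollary 4.5." (the last observation and the closing paragraph: noted; owner of
[AbsTopIII] §2/§4 = abc-iut-L4-t2, `Coorientations` / `ArchimedeanLogFrobenius`) -/

/- Rmk 3.4.2, the "elementary fact" (holomorphic automorphisms of `ℂ^×` preserving the punctured
closed unit disc are trivial): PROVED in `PuncturedPlaneHolomorphicAutomorphisms.lean`,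
`Literature.IUT.HodgeTheaters.holAutUnits_eq_id_of_preservesDisc`. -/

/-- Rmk 3.4.2, the displayed equivalence as a predicate: a Kummer structure `κ` (ranging over the
maps `OC →* A` singled out by `IsKummer` — continuous injective monoid maps `𝒪^▷(C_v) ↪ 𝒜_{D_v}`,
TODO-merge:abc-iut-L5-t2 `ArchLocalFrobenioid.kappa`) is RECOVERABLE from the pair it induces:
the Aut-holomorphic structure `autHolOf κ` on `𝒪^▷(C_v)^gp` and the co-holomorphicization
`coholOf κ` ([AbsTopIII] Def. 2.1 (i), (iv); TODO-merge:abc-iut-L4-t2 `AutHolStructure`,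
`PreCoHolomorphicization`), i.e. `κ ↦ (autHolOf κ, coholOf κ)` is injective on Kummer structures.
[claim: Mochizuki2012, status: disputed] -/
def KummerStructureRecoverable {OC : Type u} {A : Type v} [Monoid OC] [Monoid A]
    {𝔄 : Type w} {ℭ : Type*} (IsKummer : (OC →* A) → Prop) (autHolOf : (OC →* A) → 𝔄)
    (coholOf : (OC →* A) → ℭ) : Prop :=
  ∀ κ κ' : OC →* A, IsKummer κ → IsKummer κ' → autHolOf κ = autHolOf κ' → coholOf κ = coholOf κ' →
    κ = κ'

/-! ## Remark 3.4.3 (ii) ([IUTchI] Rmk 3.4.3 (ii) p.83)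

"We observe that just as the theory of elliptic cuspidalization [cf. [AbsTopII], Example 3.2;
[AbsTopII], Corollaries 3.3, 3.4] admits a straightforward holomorphic analogue … [cf. [AbsTopIII],
Corollary 2.7] …, the theory of Belyi cuspidalization [cf. [AbsTopII], Example 3.6; [AbsTopII],
Corollaries 3.7, 3.8; [AbsTopIII], Remark 2.8.3] admits a straightforward holomorphic analogue,
i.e., a theory of 'holomorphic Belyi cuspidalization'.  We leave the routine details to the reader.
(noted)  Here, we observe that one immediate consequence … may be stated as follows: the set of
NF-points [i.e., points defined over a number field] of the underlying topological space of the
Aut-holomorphic space `D_v` may be reconstructed via a functorial algorithm from the [abstract]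
Aut-holomorphic space `D_v`."  We type "reconstructed via a functorial algorithm from the abstract
Aut-holomorphic space" as functoriality on isomorphisms of Aut-holomorphic spaces: every such
isomorphism carries NF-points onto NF-points. -/

namespace S3RemarksLocal

/-- Shape: an Aut-holomorphic space ([AbsTopIII] Def. 2.1 (i); TODO-merge:abc-iut-L4-t2
`AutHolStructure`, the owner's `S3Local.AutHolOrbispace`) with a marked subset of *NF-points*
("points defined over a number field" of the underlying topological space, p. 83).
[claim: Mochizuki2012, status: disputed] -/
structure AutHolSpaceNF where
  /-- the underlying topological space -/
  carrier : Type u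
  /-- its topology -/
  [instTop : TopologicalSpace carrier]
  /-- the Aut-holomorphic structure: a group of self-homeomorphisms -/
  autHol : Subgroup (carrier ≃ₜ carrier)
  /-- the NF-points -/
  nfPoints : Set carrier

/-- the topology recorded in the data. [claim: Mochizuki2012, status: disputed] -/
instance AutHolSpaceNF.instTopologicalSpaceCarrier (X : AutHolSpaceNF.{u}) :
    TopologicalSpace X.carrier :=
  X.instTop

/-- An isomorphism of (abstract) Aut-holomorphic spaces: a homeomorphism conjugating the one group
of holomorphic automorphisms onto the other. [claim: Mochizuki2012, status: disputed] -/
def AutHolSpaceNF.IsIso (X Y : AutHolSpaceNF.{u}) (α : X.carrier ≃ₜ Y.carrier) : Prop :=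
  ∀ φ : Y.carrier ≃ₜ Y.carrier, φ ∈ Y.autHol ↔ (α.trans φ).trans α.symm ∈ X.autHol

end S3RemarksLocal

/-- Rmk 3.4.3 (ii), consequence of holomorphic Belyi cuspidalization, as a predicate on a pair of
Aut-holomorphic spaces with NF-points (to be the `D_v`'s): "the set of NF-points … may be
reconstructed via a functorial algorithm from the [abstract] Aut-holomorphic space" — every
isomorphism of the abstract Aut-holomorphic spaces maps NF-points onto NF-points.
[claim: Mochizuki2012, status: disputed] -/
def NFPointsFunctorial (X Y : S3RemarksLocal.AutHolSpaceNF.{u}) : Prop :=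
  ∀ α : X.carrier ≃ₜ Y.carrier, S3RemarksLocal.AutHolSpaceNF.IsIso X Y α →
    α '' X.nfPoints = Y.nfPoints

/-- Sanity of the functoriality reading: it is reflexive-compatible — the identity isomorphism
preserves NF-points, so `NFPointsFunctorial X X` is never vacuously false on that account. PROVED.
[claim: Mochizuki2012, status: disputed] -/
theorem S3RemarksLocal.AutHolSpaceNF.isIso_refl (X : S3RemarksLocal.AutHolSpaceNF.{u}) :
    S3RemarksLocal.AutHolSpaceNF.IsIso X X (Homeomorph.refl X.carrier) := by
  intro φ
  have : ((Homeomorph.refl X.carrier).trans φ).trans (Homeomorph.refl X.carrier).symm = φ :=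
    Homeomorph.ext fun _ => rfl
  rw [this]

end Literature.IUT.HodgeTheaters
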